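import Summits.AtomisticToContinuum.HydrodynamicLimit.Theorems.CollisionIsometryCLTAdaptedWeightCLTSustainedAnisotropyB

/-!
# Stub `stub_windowOfUI` of the line `sustained-anisotropy-superexp`, helper 1/4: kinetic windows on `ℝ`
(crux `CollisionIsometryCLT.AdaptedWeightCLT`, stmt-AtomisticToContinuum-14868; `--supports`)

Pure real analysis for the reshaped stub `stub_windowOfUI` (from the kinetic windows `[t' − Δ, t']` to the
horizon `[0, t]`), for nonnegative measurable functions `h, m : ℝ → ℝ` (bounded wherever real integrals are
used, so that every Bochner integral below is honest):
* `measurable_windowIntegral`: `(t', a) ↦ ∫_{[t'−Δ, t']} g(s, a) ds` is jointly measurable for a jointly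
  measurable `g` (Bochner integral in `s` of the indicator form, `StronglyMeasurable.integral_prod_right'`);
* WINDOW FUBINI (`lintegral_window_swap`, Tonelli): `∫_{t' ∈ [Δ,t]} ∫_{s ∈ [t'−Δ,t']} H = ∫_s H(s) λ([s, s+Δ] ∩ [Δ, t])`;
  the coverage is `≤ Δ 𝟙_{[0,t]}` and `≥ Δ 𝟙_{[Δ,t−Δ]}`, whence (WF1) `≤ Δ ∫_{[0,t]} H` (`lintegral_window_le`) and
  (WF2) `≥ Δ ∫_{[Δ,t−Δ]} H` (`le_lintegral_window`), with real forms `integral_winAvg_le`, `integral_le_winAvg_add`;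
* the DETERMINISTIC WINDOW ESTIMATE `integral_le_of_windows`: if `h ≤ A + β m` pointwise, `∫_{[0,t]} m ≤ C'`, and
  every window end `t' ∈ [Δ, t]` whose `h`-average is `≥ a` and whose `m`-average is `≤ Cw` lies in a measurable
  set `E`, then `∫_{[0,t]} h ≤ a t + A (2Δ + C'/Cw) + 3 β C' + (A + β Cw) λ(E ∩ [Δ, t])` (pointwise on `[Δ, t]`:
  window average `≤ a + (A/Cw + β)·(m-average) + (A + β Cw) 𝟙_E`, then WF1 for `m`, WF2 for `h`, and the two end
  layers `[0, Δ]`, `[t − Δ, t]` by the affine bound).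
Registered anchor: `windowOfUI_fubini_anchor` (= `integral_winAvg_le`).
-/

namespace Summit.AtomisticToContinuum.HydrodynamicLimit.Theorems.SustainedAnisotropy

open scoped BigOperators Topology Classical MeasureTheory ENNReal
open Filter Set MeasureTheory

noncomputable section

namespace WindowOfUI

/-! ## Measurability of window integrals -/

/-- For a jointly measurable `g : ℝ → α → ℝ`, the window integral `(t', a) ↦ ∫_{[t'−Δ, t']} g(s, a) ds` is
jointly measurable (the Bochner integral in `s` of the measurable function
`((t', a), s) ↦ 𝟙{t'−Δ ≤ s ≤ t'} g(s, a)`). -/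
theorem measurable_windowIntegral {α : Type*} [MeasurableSpace α] {g : ℝ → α → ℝ}
    (hg : Measurable (Function.uncurry g)) (Δ : ℝ) :
    Measurable fun p : ℝ × α => ∫ s in Icc (p.1 - Δ) p.1, g s p.2 := by
  have hS : MeasurableSet {q : (ℝ × α) × ℝ | q.1.1 - Δ ≤ q.2 ∧ q.2 ≤ q.1.1} :=
    (measurableSet_le (measurable_fst.fst.sub_const Δ) measurable_snd).inter
      (measurableSet_le measurable_snd measurable_fst.fst)
  have hGm : Measurable fun q : (ℝ × α) × ℝ =>
      if q.1.1 - Δ ≤ q.2 ∧ q.2 ≤ q.1.1 then g q.2 q.1.2 else 0 :=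
    Measurable.ite hS (hg.comp (measurable_snd.prodMk measurable_fst.snd)) measurable_const
  have heq : (fun p : ℝ × α => ∫ s in Icc (p.1 - Δ) p.1, g s p.2) = fun p => ∫ s,
      (fun q : (ℝ × α) × ℝ => if q.1.1 - Δ ≤ q.2 ∧ q.2 ≤ q.1.1 then g q.2 q.1.2 else 0) (p, s) := by
    funext p
    rw [← integral_indicator measurableSet_Icc]
    congr 1
    funext s
    simp only [Set.indicator, mem_Icc]
  rw [heq]
  exact (hGm.stronglyMeasurable.integral_prod_right' (ν := (volume : Measure ℝ))).measurable

/-- Window integrals of a measurable `h : ℝ → ℝ` are measurable in the window end. -/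
theorem measurable_windowIntegral_real {h : ℝ → ℝ} (hh : Measurable h) (Δ : ℝ) :
    Measurable fun t' : ℝ => ∫ s in Icc (t' - Δ) t', h s := by
  have h1 : Measurable (Function.uncurry fun (s : ℝ) (_ : Unit) => h s) := hh.comp measurable_fst
  exact (measurable_windowIntegral h1 Δ).comp (measurable_id.prodMk (measurable_const (a := ())))

/-! ## Window Fubini -/

/-- WINDOW FUBINI (Tonelli form): integrating the window integrals of `H ≥ 0` over the window end
`t' ∈ [Δ, t]` weighs `H(s)` by the coverage `λ([s, s + Δ] ∩ [Δ, t])`. -/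
theorem lintegral_window_swap {H : ℝ → ℝ≥0∞} (hH : Measurable H) (Δ t : ℝ) :
    ∫⁻ t' in Icc Δ t, ∫⁻ s in Icc (t' - Δ) t', H s = ∫⁻ s, H s * volume (Icc s (s + Δ) ∩ Icc Δ t) := by
  set K : Set (ℝ × ℝ) := {q | q.1 - Δ ≤ q.2 ∧ q.2 ≤ q.1} with hK
  have hKm : MeasurableSet K :=
    (measurableSet_le (measurable_fst.sub_const Δ) measurable_snd).inter
      (measurableSet_le measurable_snd measurable_fst)
  have hGm : Measurable fun q : ℝ × ℝ => K.indicator (fun q => H q.2) q :=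
    (hH.comp measurable_snd).indicator hKm
  have h1 : ∀ t', ∫⁻ s in Icc (t' - Δ) t', H s = ∫⁻ s, K.indicator (fun q => H q.2) (t', s) := by
    intro t'
    rw [← lintegral_indicator measurableSet_Icc]
    refine lintegral_congr fun s => ?_
    simp only [hK, Set.indicator, mem_Icc, mem_setOf_eq]
  have h2 : ∀ s, (fun t' => K.indicator (fun q => H q.2) (t', s)) =
      (Icc s (s + Δ)).indicator (fun _ => H s) := by
    intro s
    funext t'
    have hiff : (t' - Δ ≤ s ∧ s ≤ t') ↔ (s ≤ t' ∧ t' ≤ s + Δ) := by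
      constructor <;> rintro ⟨h₁, h₂⟩ <;> exact ⟨by linarith, by linarith⟩
    simp only [hK, Set.indicator, mem_Icc, mem_setOf_eq, hiff]
  simp_rw [h1]
  rw [lintegral_lintegral_swap hGm.aemeasurable]
  congr 1
  funext s
  rw [h2 s, lintegral_indicator_const measurableSet_Icc, Measure.restrict_apply measurableSet_Icc]

/-- The coverage of `s` by windows ending in `[Δ, t]` is at most `Δ` and vanishes off `[0, t]`. -/
theorem volume_window_inter_le {Δ t : ℝ} (s : ℝ) :
    volume (Icc s (s + Δ) ∩ Icc Δ t) ≤ (Icc 0 t).indicator (fun _ => ENNReal.ofReal Δ) s := by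
  by_cases hs : s ∈ Icc 0 t
  · rw [indicator_of_mem hs]
    calc volume (Icc s (s + Δ) ∩ Icc Δ t) ≤ volume (Icc s (s + Δ)) := measure_mono inter_subset_left
      _ = ENNReal.ofReal Δ := by rw [Real.volume_Icc, add_sub_cancel_left]
  · have hempty : Icc s (s + Δ) ∩ Icc Δ t = ∅ := by
      ext x
      simp only [mem_inter_iff, mem_Icc, mem_empty_iff_false, iff_false, not_and, and_imp]
      intro h1 h2 h3 h4
      rw [mem_Icc, not_and_or, not_le, not_le] at hs
      rcases hs with hs | hs <;> linarith
    rw [indicator_of_notMem hs, nonpos_iff_eq_zero, hempty, measure_empty]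

/-- The coverage of `s ∈ [Δ, t − Δ]` is exactly `Δ`. -/
theorem le_volume_window_inter {Δ t : ℝ} (s : ℝ) :
    (Icc Δ (t - Δ)).indicator (fun _ => ENNReal.ofReal Δ) s ≤ volume (Icc s (s + Δ) ∩ Icc Δ t) := by
  by_cases hs : s ∈ Icc Δ (t - Δ)
  · rw [indicator_of_mem hs]
    have hsub : Icc s (s + Δ) ⊆ Icc Δ t := Icc_subset_Icc hs.1 (by linarith [hs.2])
    rw [inter_eq_left.2 hsub, Real.volume_Icc, add_sub_cancel_left]
  · rw [indicator_of_notMem hs]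
    exact bot_le

/-- WF1: `∫_{t' ∈ [Δ,t]} ∫_{[t'−Δ,t']} H ≤ Δ ∫_{[0,t]} H`. -/
theorem lintegral_window_le {H : ℝ → ℝ≥0∞} (hH : Measurable H) (Δ t : ℝ) :
    ∫⁻ t' in Icc Δ t, ∫⁻ s in Icc (t' - Δ) t', H s ≤ ENNReal.ofReal Δ * ∫⁻ s in Icc 0 t, H s := by
  rw [lintegral_window_swap hH Δ t]
  calc ∫⁻ s, H s * volume (Icc s (s + Δ) ∩ Icc Δ t)
      ≤ ∫⁻ s, H s * (Icc 0 t).indicator (fun _ => ENNReal.ofReal Δ) s :=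
        lintegral_mono fun s => by gcongr; exact volume_window_inter_le s
    _ = ∫⁻ s, (Icc 0 t).indicator (fun s => H s * ENNReal.ofReal Δ) s := by
        congr 1
        funext s
        by_cases hs : s ∈ Icc 0 t
        · simp only [indicator_of_mem hs]
        · simp only [indicator_of_notMem hs, mul_zero]
    _ = ENNReal.ofReal Δ * ∫⁻ s in Icc 0 t, H s := by
        rw [lintegral_indicator measurableSet_Icc, lintegral_mul_const _ hH, mul_comm]

/-- WF2 (main piece): `Δ ∫_{[Δ,t−Δ]} H ≤ ∫_{t' ∈ [Δ,t]} ∫_{[t'−Δ,t']} H`. -/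
theorem le_lintegral_window {H : ℝ → ℝ≥0∞} (hH : Measurable H) (Δ t : ℝ) :
    ENNReal.ofReal Δ * ∫⁻ s in Icc Δ (t - Δ), H s ≤ ∫⁻ t' in Icc Δ t, ∫⁻ s in Icc (t' - Δ) t', H s := by
  rw [lintegral_window_swap hH Δ t]
  calc ENNReal.ofReal Δ * ∫⁻ s in Icc Δ (t - Δ), H s
      = ∫⁻ s, (Icc Δ (t - Δ)).indicator (fun s => H s * ENNReal.ofReal Δ) s := by
        rw [lintegral_indicator measurableSet_Icc, lintegral_mul_const _ hH, mul_comm]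
    _ = ∫⁻ s, H s * (Icc Δ (t - Δ)).indicator (fun _ => ENNReal.ofReal Δ) s := by
        congr 1
        funext s
        by_cases hs : s ∈ Icc Δ (t - Δ)
        · simp only [indicator_of_mem hs]
        · simp only [indicator_of_notMem hs, mul_zero]
    _ ≤ ∫⁻ s, H s * volume (Icc s (s + Δ) ∩ Icc Δ t) :=
        lintegral_mono fun s => by gcongr; exact le_volume_window_inter s

/-- `[0, t] ⊆ [0, Δ] ∪ [Δ, t − Δ] ∪ [t − Δ, t]`, integrated. -/
theorem lintegral_Icc_le_three (H : ℝ → ℝ≥0∞) (Δ t : ℝ) :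
    ∫⁻ s in Icc 0 t, H s ≤
      (∫⁻ s in Icc 0 Δ, H s) + (∫⁻ s in Icc Δ (t - Δ), H s) + ∫⁻ s in Icc (t - Δ) t, H s := by
  have hsub : Icc 0 t ⊆ (Icc 0 Δ ∪ Icc Δ (t - Δ)) ∪ Icc (t - Δ) t := by
    intro s hs
    simp only [mem_union, mem_Icc] at hs ⊢
    by_cases h1 : s ≤ Δ
    · exact Or.inl (Or.inl ⟨hs.1, h1⟩)
    by_cases h2 : s ≤ t - Δ
    · exact Or.inl (Or.inr ⟨le_of_lt (not_le.1 h1), h2⟩)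
    · exact Or.inr ⟨le_of_lt (not_le.1 h2), hs.2⟩
  calc ∫⁻ s in Icc 0 t, H s ≤ ∫⁻ s in (Icc 0 Δ ∪ Icc Δ (t - Δ)) ∪ Icc (t - Δ) t, H s :=
        lintegral_mono_set hsub
    _ ≤ _ := (lintegral_union_le _ _ _).trans (add_le_add (lintegral_union_le _ _ _) le_rfl)

/-! ## Real forms for bounded nonnegative measurable functions -/

/-- A bounded measurable real function is integrable on every compact interval. -/
theorem integrableOn_Icc_of_bdd {h : ℝ → ℝ} (hh : Measurable h) {B : ℝ} (hB : ∀ s, |h s| ≤ B)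
    (a b : ℝ) : IntegrableOn h (Icc a b) :=
  IntegrableOn.of_bound measure_Icc_lt_top hh.aestronglyMeasurable.restrict B
    (ae_of_all _ fun s => by rw [Real.norm_eq_abs]; exact hB s)

/-- `|h| ≤ B` from `0 ≤ h ≤ B`. -/
theorem abs_le_of_nonneg_le {h : ℝ → ℝ} (h0 : ∀ s, 0 ≤ h s) {B : ℝ} (hB : ∀ s, h s ≤ B) (s : ℝ) :
    |h s| ≤ B := by
  rw [abs_of_nonneg (h0 s)]
  exact hB s

/-- Real and extended integrals of a bounded nonnegative measurable function over an interval agree. -/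
theorem ofReal_setIntegral_Icc {h : ℝ → ℝ} (hh : Measurable h) (h0 : ∀ s, 0 ≤ h s) {B : ℝ}
    (hB : ∀ s, h s ≤ B) (a b : ℝ) :
    ENNReal.ofReal (∫ s in Icc a b, h s) = ∫⁻ s in Icc a b, ENNReal.ofReal (h s) :=
  ofReal_integral_eq_lintegral_ofReal (integrableOn_Icc_of_bdd hh (abs_le_of_nonneg_le h0 hB) a b)
    (ae_of_all _ h0)

/-- Window averages of `0 ≤ h ≤ B` lie in `[0, B]`. -/
theorem winAvg_mem {h : ℝ → ℝ} (h0 : ∀ s, 0 ≤ h s) {B : ℝ} (hB : ∀ s, h s ≤ B) {Δ : ℝ} (hΔ : 0 < Δ)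
    (t' : ℝ) : 0 ≤ Δ⁻¹ * ∫ s in Icc (t' - Δ) t', h s ∧ Δ⁻¹ * ∫ s in Icc (t' - Δ) t', h s ≤ B := by
  have h1 : 0 ≤ ∫ s in Icc (t' - Δ) t', h s := integral_nonneg fun s => h0 s
  refine ⟨mul_nonneg (inv_nonneg.2 hΔ.le) h1, ?_⟩
  have h2 := norm_setIntegral_le_of_norm_le_const (measure_Icc_lt_top (μ := (volume : Measure ℝ)))
    (f := h) (s := Icc (t' - Δ) t') (C := B)
    (fun s _ => by rw [Real.norm_eq_abs]; exact abs_le_of_nonneg_le h0 hB s)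
  rw [Real.norm_eq_abs, abs_of_nonneg h1, Real.volume_real_Icc_of_le (by linarith),
    sub_sub_cancel] at h2
  rw [inv_mul_le_iff₀ hΔ, mul_comm]
  exact h2

/-- WF1 (real form): for measurable `0 ≤ h ≤ B` and `0 < Δ`,
`∫_{t' ∈ [Δ,t]} Δ⁻¹ ∫_{[t'−Δ,t']} h ≤ ∫_{[0,t]} h`. -/
theorem integral_winAvg_le {h : ℝ → ℝ} (hh : Measurable h) (h0 : ∀ s, 0 ≤ h s) {B : ℝ}
    (hB : ∀ s, h s ≤ B) {Δ : ℝ} (hΔ : 0 < Δ) (t : ℝ) :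
    ∫ t' in Icc Δ t, Δ⁻¹ * ∫ s in Icc (t' - Δ) t', h s ≤ ∫ s in Icc 0 t, h s := by
  have hw0 : ∀ t', 0 ≤ ∫ s in Icc (t' - Δ) t', h s := fun t' => integral_nonneg fun s => h0 s
  have hwB : ∀ t', ∫ s in Icc (t' - Δ) t', h s ≤ B * Δ := fun t' => by
    have h := (winAvg_mem h0 hB hΔ t').2
    rwa [inv_mul_le_iff₀ hΔ, mul_comm] at h
  have hwi : IntegrableOn (fun t' => ∫ s in Icc (t' - Δ) t', h s) (Icc Δ t) :=
    integrableOn_Icc_of_bdd (measurable_windowIntegral_real hh Δ) (abs_le_of_nonneg_le hw0 hwB) Δ t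
  have hI0 : 0 ≤ ∫ s in Icc 0 t, h s := integral_nonneg fun s => h0 s
  rw [integral_const_mul, inv_mul_le_iff₀ hΔ, ← ENNReal.ofReal_le_ofReal_iff (mul_nonneg hΔ.le hI0),
    ENNReal.ofReal_mul hΔ.le, ofReal_integral_eq_lintegral_ofReal hwi (ae_of_all _ hw0),
    ofReal_setIntegral_Icc hh h0 hB 0 t]
  calc ∫⁻ t' in Icc Δ t, ENNReal.ofReal (∫ s in Icc (t' - Δ) t', h s)
      = ∫⁻ t' in Icc Δ t, ∫⁻ s in Icc (t' - Δ) t', ENNReal.ofReal (h s) := by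
        congr 1
        funext t'
        exact ofReal_setIntegral_Icc hh h0 hB _ _
    _ ≤ ENNReal.ofReal Δ * ∫⁻ s in Icc 0 t, ENNReal.ofReal (h s) :=
        lintegral_window_le hh.ennreal_ofReal Δ t

/-- WF2 (real form): for measurable `0 ≤ h ≤ B` and `0 < Δ`,
`∫_{[0,t]} h ≤ ∫_{t'∈[Δ,t]} Δ⁻¹ ∫_{[t'−Δ,t']} h + ∫_{[0,Δ]} h + ∫_{[t−Δ,t]} h`. -/
theorem integral_le_winAvg_add {h : ℝ → ℝ} (hh : Measurable h) (h0 : ∀ s, 0 ≤ h s) {B : ℝ}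
    (hB : ∀ s, h s ≤ B) {Δ : ℝ} (hΔ : 0 < Δ) (t : ℝ) :
    ∫ s in Icc 0 t, h s ≤ (∫ t' in Icc Δ t, Δ⁻¹ * ∫ s in Icc (t' - Δ) t', h s) +
      (∫ s in Icc 0 Δ, h s) + ∫ s in Icc (t - Δ) t, h s := by
  have I := ofReal_setIntegral_Icc hh h0 hB
  have I0 : ∀ a b, 0 ≤ ∫ s in Icc a b, h s := fun a b => integral_nonneg fun s => h0 s
  -- the three pieces
  have h3 : ∫ s in Icc 0 t, h s ≤
      (∫ s in Icc 0 Δ, h s) + (∫ s in Icc Δ (t - Δ), h s) + ∫ s in Icc (t - Δ) t, h s := by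
    rw [← ENNReal.ofReal_le_ofReal_iff (add_nonneg (add_nonneg (I0 _ _) (I0 _ _)) (I0 _ _)),
      ENNReal.ofReal_add (add_nonneg (I0 _ _) (I0 _ _)) (I0 _ _), ENNReal.ofReal_add (I0 _ _) (I0 _ _),
      I, I, I, I]
    exact lintegral_Icc_le_three _ Δ t
  -- the middle piece is below the window term
  have hw0 : ∀ t', 0 ≤ ∫ s in Icc (t' - Δ) t', h s := fun t' => integral_nonneg fun s => h0 s
  have hwB : ∀ t', ∫ s in Icc (t' - Δ) t', h s ≤ B * Δ := fun t' => by
    have h := (winAvg_mem h0 hB hΔ t').2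
    rwa [inv_mul_le_iff₀ hΔ, mul_comm] at h
  have hwi : IntegrableOn (fun t' => ∫ s in Icc (t' - Δ) t', h s) (Icc Δ t) :=
    integrableOn_Icc_of_bdd (measurable_windowIntegral_real hh Δ) (abs_le_of_nonneg_le hw0 hwB) Δ t
  have hmid : ∫ s in Icc Δ (t - Δ), h s ≤ ∫ t' in Icc Δ t, Δ⁻¹ * ∫ s in Icc (t' - Δ) t', h s := by
    rw [integral_const_mul, le_inv_mul_iff₀ hΔ,
      ← ENNReal.ofReal_le_ofReal_iff (integral_nonneg fun t' => hw0 t'), ENNReal.ofReal_mul hΔ.le, I,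
      ofReal_integral_eq_lintegral_ofReal hwi (ae_of_all _ hw0)]
    calc ENNReal.ofReal Δ * ∫⁻ s in Icc Δ (t - Δ), ENNReal.ofReal (h s)
        ≤ ∫⁻ t' in Icc Δ t, ∫⁻ s in Icc (t' - Δ) t', ENNReal.ofReal (h s) :=
          le_lintegral_window hh.ennreal_ofReal Δ t
      _ = ∫⁻ t' in Icc Δ t, ENNReal.ofReal (∫ s in Icc (t' - Δ) t', h s) := by
          congr 1
          funext t'
          exact (I _ _).symm
  linarith

/-! ## The deterministic window estimate -/

/-- Integrating a pointwise affine bound `h ≤ A + β m` over an interval. -/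
theorem setIntegral_le_affine {h m : ℝ → ℝ} (hh : Measurable h) (hm : Measurable m) {B : ℝ}
    (hhB : ∀ s, |h s| ≤ B) (hmB : ∀ s, |m s| ≤ B) {A β : ℝ} (hAm : ∀ s, h s ≤ A + β * m s)
    {a b : ℝ} (hab : a ≤ b) :
    ∫ s in Icc a b, h s ≤ A * (b - a) + β * ∫ s in Icc a b, m s := by
  have hi := integrableOn_Icc_of_bdd hh hhB a b
  have hmi := integrableOn_Icc_of_bdd hm hmB a b
  have hc : IntegrableOn (fun _ : ℝ => A) (Icc a b) := integrableOn_const (hs := measure_Icc_lt_top.ne)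
  calc ∫ s in Icc a b, h s ≤ ∫ s in Icc a b, (A + β * m s) :=
        integral_mono hi (hc.add (hmi.const_mul β)) fun s => hAm s
    _ = A * (b - a) + β * ∫ s in Icc a b, m s := by
        rw [integral_add (f := fun _ => A) (g := fun s => β * m s) hc (hmi.const_mul β), setIntegral_const,
          integral_const_mul, Real.volume_real_Icc_of_le hab, smul_eq_mul]
        ring

/-- **Deterministic window estimate.** For measurable `0 ≤ h, m ≤ B` on `ℝ` with `h ≤ A + β m` pointwise
(`A, β ≥ 0`), a window length `0 < Δ ≤ t`, `∫_{[0,t]} m ≤ C'`, `a ≥ 0`, `Cw > 0` and a measurable `E ⊆ ℝ`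
containing every window end `t' ∈ [Δ, t]` whose `h`-average is `≥ a` and whose `m`-average is `≤ Cw`:
`∫_{[0,t]} h ≤ a t + A (2Δ + C'/Cw) + 3 β C' + (A + β Cw) λ(E ∩ [Δ, t])`. -/
theorem integral_le_of_windows {h m : ℝ → ℝ} (hh : Measurable h) (hm : Measurable m)
    (h0 : ∀ s, 0 ≤ h s) (m0 : ∀ s, 0 ≤ m s) {B : ℝ} (hhB : ∀ s, h s ≤ B) (hmB : ∀ s, m s ≤ B)
    {A β : ℝ} (hA : 0 ≤ A) (hβ : 0 ≤ β) (hAm : ∀ s, h s ≤ A + β * m s)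
    {Δ t : ℝ} (hΔ : 0 < Δ) (hΔt : Δ ≤ t) {C' : ℝ} (hC : ∫ s in Icc 0 t, m s ≤ C')
    {a Cw : ℝ} (ha : 0 ≤ a) (hCw : 0 < Cw) {E : Set ℝ} (hE : MeasurableSet E)
    (hwin : ∀ t' ∈ Icc Δ t, a ≤ Δ⁻¹ * ∫ s in Icc (t' - Δ) t', h s →
      Δ⁻¹ * ∫ s in Icc (t' - Δ) t', m s ≤ Cw → t' ∈ E) :
    ∫ s in Icc 0 t, h s ≤ a * t + A * (2 * Δ + C' / Cw) + 3 * β * C' +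
      (A + β * Cw) * volume.real (E ∩ Icc Δ t) := by
  have habs := abs_le_of_nonneg_le h0 hhB
  have mabs := abs_le_of_nonneg_le m0 hmB
  set wh : ℝ → ℝ := fun t' => Δ⁻¹ * ∫ s in Icc (t' - Δ) t', h s with hwh
  set wm : ℝ → ℝ := fun t' => Δ⁻¹ * ∫ s in Icc (t' - Δ) t', m s with hwm
  -- `∫_{[0,t]} m ≥ 0`, hence `C' ≥ 0`
  have hC0 : 0 ≤ C' := (integral_nonneg fun s => m0 s).trans hC
  -- the affine bound averaged over a window
  have haff : ∀ t', wh t' ≤ A + β * wm t' := fun t' => by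
    simp only [hwh, hwm]
    have h1 := setIntegral_le_affine hh hm habs mabs hAm (show t' - Δ ≤ t' by linarith)
    rw [sub_sub_cancel] at h1
    calc Δ⁻¹ * ∫ s in Icc (t' - Δ) t', h s ≤ Δ⁻¹ * (A * Δ + β * ∫ s in Icc (t' - Δ) t', m s) :=
          mul_le_mul_of_nonneg_left h1 (inv_nonneg.2 hΔ.le)
      _ = A + β * (Δ⁻¹ * ∫ s in Icc (t' - Δ) t', m s) := by
          rw [mul_add, mul_comm Δ⁻¹ (A * Δ), mul_inv_cancel_right₀ hΔ.ne', mul_left_comm]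
  -- pointwise bound on `[Δ, t]`
  have hpt : ∀ t' ∈ Icc Δ t,
      wh t' ≤ a + (A / Cw + β) * wm t' + (A + β * Cw) * E.indicator 1 t' := by
    intro t' ht'
    have hwm0 : 0 ≤ wm t' := (winAvg_mem m0 hmB hΔ t').1
    have hind0 : 0 ≤ E.indicator (1 : ℝ → ℝ) t' := Set.indicator_nonneg (fun _ _ => zero_le_one) _
    have h3 : 0 ≤ (A + β * Cw) * E.indicator 1 t' := mul_nonneg (by positivity) hind0
    have h2 : 0 ≤ (A / Cw + β) * wm t' := by positivity
    have hexp : (A / Cw + β) * wm t' = A / Cw * wm t' + β * wm t' := by ring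
    rcases lt_or_ge Cw (wm t') with hc | hc
    · have h1 : A ≤ A / Cw * wm t' := by
        rw [div_mul_eq_mul_div, le_div_iff₀ hCw]
        exact mul_le_mul_of_nonneg_left hc.le hA
      linarith [haff t']
    · rcases lt_or_ge (wh t') a with hwa | hwa
      · linarith
      · have hmem : t' ∈ E := hwin t' ht' hwa hc
        rw [indicator_of_mem hmem, Pi.one_apply, mul_one]
        have h4 : β * wm t' ≤ β * Cw := mul_le_mul_of_nonneg_left hc hβ
        linarith [haff t']
  -- integrate the pointwise bound over `[Δ, t]`
  have hwhB : ∀ t', |wh t'| ≤ B := fun t' =>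
    abs_le_of_nonneg_le (fun t' => (winAvg_mem h0 hhB hΔ t').1) (fun t' => (winAvg_mem h0 hhB hΔ t').2) t'
  have hwmB : ∀ t', |wm t'| ≤ B := fun t' =>
    abs_le_of_nonneg_le (fun t' => (winAvg_mem m0 hmB hΔ t').1) (fun t' => (winAvg_mem m0 hmB hΔ t').2) t'
  have hwhm : Measurable wh := (measurable_windowIntegral_real hh Δ).const_mul _
  have hwmm : Measurable wm := (measurable_windowIntegral_real hm Δ).const_mul _
  have hwhi : IntegrableOn wh (Icc Δ t) := integrableOn_Icc_of_bdd hwhm hwhB Δ t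
  have hwmi : IntegrableOn wm (Icc Δ t) := integrableOn_Icc_of_bdd hwmm hwmB Δ t
  have hci : IntegrableOn (fun _ : ℝ => a) (Icc Δ t) := integrableOn_const (hs := measure_Icc_lt_top.ne)
  have h1i : IntegrableOn (fun _ : ℝ => (1 : ℝ)) (Icc Δ t) :=
    integrableOn_const (hs := measure_Icc_lt_top.ne)
  have hEi : IntegrableOn (fun t' => (A + β * Cw) * E.indicator 1 t') (Icc Δ t) :=
    (h1i.indicator hE).const_mul _
  have hmain : ∫ t' in Icc Δ t, wh t' ≤
      a * (t - Δ) + (A / Cw + β) * (∫ t' in Icc Δ t, wm t') + (A + β * Cw) * volume.real (E ∩ Icc Δ t) := by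
    calc ∫ t' in Icc Δ t, wh t'
        ≤ ∫ t' in Icc Δ t, (a + (A / Cw + β) * wm t' + (A + β * Cw) * E.indicator 1 t') :=
          setIntegral_mono_on hwhi ((hci.add (hwmi.const_mul _)).add hEi) measurableSet_Icc hpt
      _ = a * (t - Δ) + (A / Cw + β) * (∫ t' in Icc Δ t, wm t') +
            (A + β * Cw) * volume.real (E ∩ Icc Δ t) := by
          rw [integral_add (f := fun t' => a + (A / Cw + β) * wm t')
              (g := fun t' => (A + β * Cw) * E.indicator 1 t') (hci.add (hwmi.const_mul _)) hEi,
            integral_add (f := fun _ => a) (g := fun t' => (A / Cw + β) * wm t') hci (hwmi.const_mul _),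
            setIntegral_const, integral_const_mul (A / Cw + β) wm, integral_const_mul (A + β * Cw) (E.indicator 1),
            integral_indicator_one hE, measureReal_restrict_apply hE, Real.volume_real_Icc_of_le hΔt, smul_eq_mul]
          ring
  -- WF1 for `m`, WF2 for `h`
  have hWF1 : ∫ t' in Icc Δ t, wm t' ≤ C' := (integral_winAvg_le hm m0 hmB hΔ t).trans hC
  have hWF2 := integral_le_winAvg_add hh h0 hhB hΔ t
  -- end layers
  have hmono : ∀ {a' b' : ℝ}, Icc a' b' ⊆ Icc 0 t → ∫ s in Icc a' b', m s ≤ C' := fun hsub =>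
    (setIntegral_mono_set (integrableOn_Icc_of_bdd hm mabs 0 t) (ae_of_all _ m0)
      (ae_of_all _ hsub)).trans hC
  have hend0 : ∫ s in Icc 0 Δ, h s ≤ A * Δ + β * C' := by
    have h1 := setIntegral_le_affine hh hm habs mabs hAm hΔ.le
    rw [sub_zero] at h1
    exact h1.trans (add_le_add le_rfl (mul_le_mul_of_nonneg_left
      (hmono (Icc_subset_Icc le_rfl hΔt)) hβ))
  have hendt : ∫ s in Icc (t - Δ) t, h s ≤ A * Δ + β * C' := by
    have h1 := setIntegral_le_affine hh hm habs mabs hAm (show t - Δ ≤ t by linarith)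
    rw [sub_sub_cancel] at h1
    exact h1.trans (add_le_add le_rfl (mul_le_mul_of_nonneg_left
      (hmono (Icc_subset_Icc (by linarith) le_rfl)) hβ))
  -- bookkeeping
  have hk1 : (A / Cw + β) * (∫ t' in Icc Δ t, wm t') ≤ (A / Cw + β) * C' :=
    mul_le_mul_of_nonneg_left hWF1 (by positivity)
  have hk2 : a * (t - Δ) ≤ a * t := by nlinarith
  have hk3 : (A / Cw + β) * C' = A * (C' / Cw) + β * C' := by ring
  simp only [hwh, hwm] at hmain hk1
  linarith [hmain, hWF2, hend0, hendt, hk1, hk2, hk3]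

end WindowOfUI

/-! ## Registered anchor -/

/-- Anchor of this helper file (WF1 in real form, `WindowOfUI.integral_winAvg_le`): for a measurable
`0 ≤ h ≤ B` on `ℝ` and a window length `Δ > 0`, the window averages integrate over the window ends
`t' ∈ [Δ, t]` to at most `∫_{[0,t]} h`. -/
theorem windowOfUI_fubini_anchor : ∀ (h : ℝ → ℝ), Measurable h → (∀ s, 0 ≤ h s) → ∀ B : ℝ,
    (∀ s, h s ≤ B) → ∀ Δ : ℝ, 0 < Δ → ∀ t : ℝ,
      ∫ t' in Icc Δ t, Δ⁻¹ * ∫ s in Icc (t' - Δ) t', h s ≤ ∫ s in Icc 0 t, h s :=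
  fun _ hh h0 _ hB _ hΔ t => WindowOfUI.integral_winAvg_le hh h0 hB hΔ t

end

end Summit.AtomisticToContinuum.HydrodynamicLimit.Theorems.SustainedAnisotropy
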